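/-
Copyright (c) 2026 the pub-hodgecm-mathlib formalisation cell (harness21).  Prover seat hodgecm-mathlib-K2E1-p01 (g0),
Track B «K2-LIT» ∕ h413, unit «GlobalIndex» of the line `K2_E1_TraceFormulaBeta`, file #1: payment of the socket
`K2E1TraceFormulaBeta.GlobalIndex.sig_K2E1OrthogonalFamilyCountable` — A PAIRWISE-ORTHOGONAL FAMILY OF NON-ZERO
SUBSPACES OF A SEPARABLE INNER-PRODUCT SPACE HAS A COUNTABLE INDEX.  2026-09-03.
-/
import Literature.NumberTheory.Automorphic.AutomorphicL2Separable   -- ★ `Orthonormal.countable_index_of_separableSpace`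
import HarnessLib

/-!
# K2_E1 road (h413 = stmt-HodgeConjecture-24833), unit «GlobalIndex», file #1:
# pairwise-orthogonal non-zero submodules of a separable inner-product space are countably many

Cell `pub/hodgecm-mathlib` (D-0151), Track B (21-frontier RULING «PUSH BOTH» 2026-09-03, director req621∕req624,
chair K2-lead ORDER #1 §4.4 ∕ ORDER #2), socket module
`Summits/HodgeConjecture/HodgeConjecture/Cruxes/H413/Lines/K2_E1_TraceFormulaBetaSigs_GlobalIndex.lean`
(planner K2E1-plan (g0), ED. 2), socket **`sig_K2E1OrthogonalFamilyCountable`** (#1, size M, first rung, Mathlib side):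
in a SEPARABLE complex inner-product space `E`, a family `V : ι → Submodule ℂ E` of NON-ZERO submodules which are
PAIRWISE ORTHOGONAL has a COUNTABLE index type `ι`.  It is the input of socket #2 `sig_K2E1OccursCountable`
(law COUNTABLE of the tier-0 kit: the occurring families sit in pairwise-orthogonal isotypic parts of the separable
`L²` of the automorphic quotient), i.e. the frame «Let X be a countable set of irreducible unitary representations»
of [Rogawski1990, Prop. 13.8.1 p. 213]; [Dixmier1977, §5.4].

THE MATHEMATICS.  Pick in each `V i` a unit vector `e i` (possible since `V i ≠ ⊥`: Mathlib `Submodule.ne_bot_iff`,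
`norm_smul_inv_norm`).  For `i ≠ j` the vectors `e i ∈ V i`, `e j ∈ V j` are orthogonal (`Submodule.IsOrtho.inner_eq`),
so `e` is an ORTHONORMAL family; distinct members of an orthonormal family are at distance `√2`, hence the open balls
`B(e i, 1/2)` are pairwise disjoint and non-empty, and a separable space carries only countably many such
(Mathlib `Pairwise.countable_of_isOpen_disjoint`) — this last step is the tree's ★
`Orthonormal.countable_index_of_separableSpace` (`Literature/NumberTheory/Automorphic/AutomorphicL2Separable`,
[ReedSimon1972, Thm. II.7]), reused by name, not restated.

* §1 `exists_mem_norm_eq_one` — a non-zero submodule contains a unit vector;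
  `orthonormal_of_pairwise_isOrtho` — unit vectors chosen in pairwise-orthogonal submodules form an orthonormal family.
* §2 **`orthogonalFamilyCountable`** — `sig_K2E1OrthogonalFamilyCountable` TOKEN FOR TOKEN.

HONEST LABEL: HC_CM is proved only modulo the 7 printed citations (2 remaining named inputs: hLiu418 =
stmt-HodgeConjecture-24832, h413 = stmt-HodgeConjecture-24833) until rung 0 closes; this file is a
`--supports stmt-HodgeConjecture-24833` helper (first rung of the K2_E1 road) and retires nothing by itself.
-/

set_option autoImplicit false

noncomputable section

open scoped InnerProductSpace

namespace Summit.HodgeConjecture.HodgeConjecture.Cruxes.H413.K2E1OrthogonalFamilyCountable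

variable {E : Type*} [NormedAddCommGroup E] [InnerProductSpace ℂ E]

/-! ## §1  Unit vectors in pairwise-orthogonal submodules -/

/-- A non-zero submodule of a complex inner-product space contains a unit vector: normalise any non-zero
member (Mathlib `Submodule.ne_bot_iff`, `norm_smul_inv_norm`). [folklore] -/
theorem exists_mem_norm_eq_one {V : Submodule ℂ E} (hV : V ≠ ⊥) : ∃ e ∈ V, ‖e‖ = 1 := by
  obtain ⟨x, hxV, hx0⟩ := (Submodule.ne_bot_iff V).1 hV
  exact ⟨(‖x‖⁻¹ : ℂ) • x, V.smul_mem _ hxV, norm_smul_inv_norm hx0⟩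

/-- Unit vectors `e i ∈ V i` chosen in PAIRWISE-ORTHOGONAL submodules `V i` form an orthonormal family
(Mathlib `Submodule.IsOrtho.inner_eq`). [folklore] -/
theorem orthonormal_of_pairwise_isOrtho {ι : Type*} {V : ι → Submodule ℂ E} (hV : Pairwise fun i j => V i ⟂ V j)
    {e : ι → E} (he : ∀ i, e i ∈ V i) (hnorm : ∀ i, ‖e i‖ = 1) : Orthonormal ℂ e :=
  ⟨hnorm, fun _ _ hij => (hV hij).inner_eq (he _) (he _)⟩

/-! ## §2  The head -/

/-- **PAYMENT OF `sig_K2E1OrthogonalFamilyCountable`** (socket #1 of unit «GlobalIndex» of the K2_E1 road,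
`Cruxes/H413/Lines/K2_E1_TraceFormulaBetaSigs_GlobalIndex.lean`, TOKEN FOR TOKEN): in a separable complex
inner-product space, a family of pairwise-orthogonal non-zero submodules has a countable index — a unit vector in
each (§1) gives an orthonormal family, whose index is countable by ★ `Orthonormal.countable_index_of_separableSpace`
(members pairwise at distance `√2`; a separable space has no uncountable family of disjoint non-empty open balls).
The frame «X countable» of Rogawski's Prop. 13.8.1.
[cite: Dixmier1977, §5.4] [cite: ReedSimon1972, Thm. II.7] [cite: Rogawski1990, §13.8 Prop. 13.8.1 p. 213] -/
theorem orthogonalFamilyCountable :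
    ∀ {E : Type*} [NormedAddCommGroup E] [InnerProductSpace ℂ E] [TopologicalSpace.SeparableSpace E] {ι : Type*} (V : ι → Submodule ℂ E),
      (∀ i, V i ≠ ⊥) → Pairwise (fun i j => V i ⟂ V j) → Countable ι := by
  intro E _ _ _ ι V hne hortho
  choose e he_mem he_norm using fun i => exists_mem_norm_eq_one (hne i)
  exact (orthonormal_of_pairwise_isOrtho hortho he_mem he_norm).countable_index_of_separableSpace

end Summit.HodgeConjecture.HodgeConjecture.Cruxes.H413.K2E1OrthogonalFamilyCountable

end
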